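import Mathlib.Probability.Process.HittingTime
import Mathlib.Topology.MetricSpace.HausdorffDistance
import HarnessLib

/-!
# Hitting times of closed sets by continuous adapted processes; exit from an open interval

Topic `Probability/Process`. For a process `u : ℝ≥0 → Ω → E` with *everywhere continuous* paths in
a (pseudo)metric space `E`, adapted to a filtration `f` of the raw kind used throughout
`Literature` (no usual conditions), and a **closed** set `s ⊆ E`:

* `Literature.Probability.Process.hittingAfter_zero_le_coe_iff` — the first hitting time `hittingAfter u s 0 ω` (Mathlib,
  valued in `WithTop ℝ≥0`) is `≤ i` iff the path visits `s` at some time `≤ i` (the infimum is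
  attained: `Literature.Probability.Process.mem_of_hittingAfter_zero_eq_coe`);
* `Literature.Probability.Process.isStoppingTime_hittingAfter_of_continuous` — it is a **stopping time** of `f` in Mathlib's
  sense (`{τ ≤ i} ∈ f i`), by the countable description
  `{τ ≤ i} = ⋂ₙ ⋃_{q ∈ D} {infDist (u q) s < 1/(n+1)}` over a countable dense `D ⊆ [0, i]`
  (continuity of paths and compactness of `[0, i]`);
* for a real process started inside an open interval `(a, b)`, the **exit time**
  `Literature.exitTime u a b = hittingAfter u (Set.Ioo a b)ᶜ 0` and the process stopped there
  (Mathlib `stoppedProcess`): the stopped paths are continuous, stay in `[a, b]`, equal the path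
  before the exit time, and sit at an endpoint `a` or `b` from the exit time on
  (`Literature.Probability.Process.apply_eq_or_eq_of_exitTime_eq_coe`, `Literature.Probability.Process.stoppedProcess_exitTime_mem_Icc`); the stopped
  process is strongly adapted (`Literature.Probability.Process.stronglyAdapted_stoppedProcess_exitTime`, from Mathlib's
  `IsStronglyProgressive.stronglyAdapted_stoppedProcess`).

These are the measure-theoretic preliminaries of the exit problem for the real Loewner/Bessel
flow of SLE_κ (Rohde–Schramm (2005), proof of Lemma 6.2: `T = inf{t : Y_x(t) ∉ (a, b)}`).

## Mathlib and Literature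

We USE `MeasureTheory.hittingAfter`, `MeasureTheory.IsStoppingTime` (with
`IsStoppingTime.measurable'` / `IsStoppingTime.measurableSet_eq_top`: stopping times of an
`ℝ≥0`-filtration are measurable, so e.g. `{τ ≠ ⊤}` is an event), `MeasureTheory.stoppedProcess`,
`MeasureTheory.StronglyAdapted.isStronglyProgressive_of_continuous`,
`MeasureTheory.IsStronglyProgressive.stronglyAdapted_stoppedProcess`, `Metric.infDist`. Mathlib
proves that hitting times are stopping times only for discrete (well-founded) time
(`Adapted.isStoppingTime_hittingAfter`); the continuous-time closed-set case below is not in Mathlib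
(searched `isStoppingTime_hitting`, `hittingAfter`, `IsClosed`).

Two small lemmas here DUPLICATE lemmas of the (much heavier, differently layered) proof file
`Literature.Analysis.FunctionSpaces.ItoProcessesProofs`, which this light file must not import:
`Literature.Probability.Process.untopA_min_coe_le` = `Literature.Analysis.FunctionSpaces.untopA_min_le` there (same statement and argument order) and
`Literature.Probability.Process.continuous_stoppedProcess_path` ⊇ `Literature.Analysis.FunctionSpaces.continuous_stoppedProcess_apply` there (the `ℝ`-valued
case). This file is the intended home of the stopped-clock API (the librarian may later redirect
`ItoProcessesProofs` to import it).

## References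

* D. Revuz, M. Yor, *Continuous Martingales and Brownian Motion* (3rd ed., 1999), Ch. I, §4,
  Prop. (4.6) (the hitting time of a closed set by a continuous adapted process is a stopping
  time).
* S. Rohde, O. Schramm, *Basic properties of SLE*, Ann. of Math. 161 (2005), §6, proof of
  Lemma 6.2.
-/

noncomputable section

open MeasureTheory Filter Topology Set Metric
open scoped NNReal

namespace Literature.Probability.Process

variable {Ω E : Type*} {mΩ : MeasurableSpace Ω}

/-! ### First hitting time of a closed set by a continuous path -/

section HittingBasic

variable {u : ℝ≥0 → Ω → E} {s : Set E} {ω : Ω}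

/-- If the path visits `s`, the hitting time is the (coerced) infimum of the visiting times.
[folklore] -/
theorem hittingAfter_zero_apply_of_exists (h : ∃ j, u j ω ∈ s) :
    hittingAfter u s 0 ω = ((sInf {j | u j ω ∈ s} : ℝ≥0) : WithTop ℝ≥0) := by
  classical
  rw [hittingAfter_def]
  simp only [zero_le, true_and]
  rw [if_pos h]

/-- If the path never visits `s`, the hitting time is `⊤` (the `n = 0` instance of Mathlib's
`hittingAfter_eq_top_iff`). [folklore] -/
theorem hittingAfter_zero_apply_of_forall (h : ∀ j, u j ω ∉ s) :
    hittingAfter u s 0 ω = ⊤ := by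
  classical
  rw [hittingAfter_def]
  simp only [zero_le, true_and]
  rw [if_neg (not_exists.2 h)]

/-- The hitting time is finite iff the path visits `s` (the `n = 0` instance of Mathlib's
`hittingAfter_eq_top_iff`, negated). [folklore] -/
theorem hittingAfter_zero_ne_top_iff : hittingAfter u s 0 ω ≠ ⊤ ↔ ∃ j, u j ω ∈ s := by
  constructor
  · intro h
    by_contra hne
    exact h (hittingAfter_zero_apply_of_forall (not_exists.1 hne))
  · intro hex
    rw [hittingAfter_zero_apply_of_exists hex]
    exact WithTop.coe_ne_top

/-- Before the hitting time the path is outside `s` (Mathlib `notMem_of_lt_hittingAfter`, time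
`0`). [folklore] -/
theorem notMem_of_coe_lt_hittingAfter_zero {t : ℝ≥0}
    (h : (t : WithTop ℝ≥0) < hittingAfter u s 0 ω) : u t ω ∉ s :=
  notMem_of_lt_hittingAfter h bot_le

end HittingBasic

section HittingClosedTop

variable [TopologicalSpace E] {u : ℝ≥0 → Ω → E} {s : Set E} {ω : Ω}

/-- **The infimum is attained** (closed set, continuous path): if the hitting time is the finite
time `T`, the path is in `s` at time `T`. Revuz–Yor (1999), Ch. I, §4. [folklore] -/
theorem mem_of_hittingAfter_zero_eq_coe (hs : IsClosed s) (hc : Continuous fun t ↦ u t ω)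
    {T : ℝ≥0} (hT : hittingAfter u s 0 ω = T) : u T ω ∈ s := by
  have hex : ∃ j, u j ω ∈ s :=
    hittingAfter_zero_ne_top_iff.1 (by rw [hT]; exact WithTop.coe_ne_top)
  rw [hittingAfter_zero_apply_of_exists hex, WithTop.coe_eq_coe] at hT
  have hclosed : IsClosed {j | u j ω ∈ s} := hs.preimage hc
  have hmem := hclosed.csInf_mem hex (OrderBot.bddBelow _)
  rw [hT] at hmem
  exact hmem

/-- **`{τ ≤ i}` is "the path has visited `s` by time `i`"** (closed set, continuous path).
Revuz–Yor (1999), Ch. I, §4, Prop. (4.6). [folklore] -/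
theorem hittingAfter_zero_le_coe_iff (hs : IsClosed s) (hc : Continuous fun t ↦ u t ω)
    {i : ℝ≥0} : hittingAfter u s 0 ω ≤ i ↔ ∃ j ≤ i, u j ω ∈ s := by
  constructor
  · intro hle
    have hne : hittingAfter u s 0 ω ≠ ⊤ := ne_top_of_le_ne_top WithTop.coe_ne_top hle
    obtain ⟨T, hT⟩ := WithTop.ne_top_iff_exists.1 hne
    refine ⟨T, ?_, mem_of_hittingAfter_zero_eq_coe hs hc hT.symm⟩
    rw [← hT] at hle
    exact WithTop.coe_le_coe.1 hle
  · rintro ⟨j, hji, hj⟩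
    rw [hittingAfter_zero_apply_of_exists ⟨j, hj⟩, WithTop.coe_le_coe]
    exact (csInf_le (OrderBot.bddBelow {j | u j ω ∈ s}) (show j ∈ {j | u j ω ∈ s} from hj)).trans hji

end HittingClosedTop

section HittingClosed

variable [PseudoMetricSpace E] {u : ℝ≥0 → Ω → E} {s : Set E} {ω : Ω}

/-- The event `{τ ≤ i}` described countably: for a nonempty closed `s`, continuous paths and a
dense `D ⊆ [0, i]`, the path visits `s` by time `i` iff for every `n` some `q ∈ D` has
`infDist (u q ω) s < 1/(n+1)` (density for `⇒`; compactness of `[0, i]` and closedness of `s` for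
`⇐`). Revuz–Yor (1999), Ch. I, §4, proof of Prop. (4.6). [folklore] -/
theorem exists_le_mem_iff_forall_exists_infDist_lt (hs : IsClosed s) (hne : s.Nonempty)
    (hc : Continuous fun t ↦ u t ω) {i : ℝ≥0} {D : Set (Iic i)} (hD : Dense D) :
    (∃ j ≤ i, u j ω ∈ s) ↔
      ∀ n : ℕ, ∃ q ∈ D, infDist (u (q : ℝ≥0) ω) s < 1 / ((n : ℝ) + 1) := by
  constructor
  · rintro ⟨j, hji, hj⟩ n
    have hcont : Continuous fun q : Iic i ↦ infDist (u (q : ℝ≥0) ω) s :=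
      ((continuous_infDist_pt s).comp hc).comp continuous_subtype_val
    have hopen : IsOpen {q : Iic i | infDist (u (q : ℝ≥0) ω) s < 1 / ((n : ℝ) + 1)} :=
      isOpen_lt hcont continuous_const
    have hj0 : infDist (u j ω) s = 0 := infDist_zero_of_mem hj
    have hmem : (⟨j, hji⟩ : Iic i) ∈ {q : Iic i | infDist (u (q : ℝ≥0) ω) s < 1 / ((n : ℝ) + 1)} := by
      simp only [mem_setOf_eq, hj0]
      positivity
    obtain ⟨q, hq1, hq2⟩ := hD.inter_open_nonempty _ hopen ⟨_, hmem⟩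
    exact ⟨q, hq2, hq1⟩
  · intro h
    choose q hqD hq using h
    obtain ⟨a, ha, φ, hφ, hlim⟩ := (isCompact_Icc (a := (0 : ℝ≥0)) (b := i)).tendsto_subseq
      (x := fun n ↦ ((q n : Iic i) : ℝ≥0)) fun n ↦ ⟨bot_le, (q n).2⟩
    refine ⟨a, ha.2, ?_⟩
    have hcont : Continuous fun t ↦ infDist (u t ω) s := (continuous_infDist_pt s).comp hc
    have h1 : Tendsto (fun n ↦ infDist (u ((q (φ n) : Iic i) : ℝ≥0) ω) s) atTop
        (𝓝 (infDist (u a ω) s)) := (hcont.tendsto a).comp hlim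
    have h2 : Tendsto (fun n ↦ infDist (u ((q (φ n) : Iic i) : ℝ≥0) ω) s) atTop (𝓝 0) := by
      refine squeeze_zero (fun n ↦ infDist_nonneg) (fun n ↦ (hq (φ n)).le) ?_
      have h3 : Tendsto (fun n : ℕ ↦ 1 / ((n : ℝ) + 1)) atTop (𝓝 0) :=
        tendsto_one_div_add_atTop_nhds_zero_nat
      exact h3.comp hφ.tendsto_atTop
    have h0 : infDist (u a ω) s = 0 := tendsto_nhds_unique h1 h2
    exact (hs.mem_iff_infDist_zero hne).2 h0

variable [MeasurableSpace E] [OpensMeasurableSpace E]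

/-- **The hitting time of a closed set by a continuous adapted process is a stopping time** (raw
filtration, everywhere-continuous paths): `{τ ≤ i} ∈ f i` for every `i`, by the countable
description `exists_le_mem_iff_forall_exists_infDist_lt` over a countable dense subset of
`[0, i]`. Revuz–Yor, *Continuous Martingales and Brownian Motion* (1999), Ch. I, §4,
Prop. (4.6). [cite: RevuzYor1999, Ch. I Prop. (4.6)] -/
theorem isStoppingTime_hittingAfter_of_continuous {f : Filtration ℝ≥0 mΩ} (hu : Adapted f u)
    (hc : ∀ ω, Continuous fun t ↦ u t ω) (hs : IsClosed s) :
    IsStoppingTime f (hittingAfter u s 0) := by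
  intro i
  have hset : {ω | hittingAfter u s 0 ω ≤ i} = {ω | ∃ j ≤ i, u j ω ∈ s} := by
    ext ω
    exact hittingAfter_zero_le_coe_iff hs (hc ω)
  rw [hset]
  rcases s.eq_empty_or_nonempty with rfl | hne
  · simp
  obtain ⟨D, hDc, hDd⟩ := TopologicalSpace.exists_countable_dense (Iic i)
  have key : {ω | ∃ j ≤ i, u j ω ∈ s} =
      ⋂ n : ℕ, ⋃ q ∈ D, {ω | infDist (u (q : ℝ≥0) ω) s < 1 / ((n : ℝ) + 1)} := by
    ext ω
    rw [mem_setOf_eq, exists_le_mem_iff_forall_exists_infDist_lt hs hne (hc ω) hDd]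
    simp only [mem_iInter, mem_iUnion, mem_setOf_eq, exists_prop]
  rw [key]
  refine MeasurableSet.iInter fun n ↦ MeasurableSet.biUnion hDc fun q _ ↦ ?_
  have hm : Measurable[f i] (u (q : ℝ≥0)) := (hu (q : ℝ≥0)).mono (f.mono q.2) le_rfl
  exact measurableSet_lt ((continuous_infDist_pt s).measurable.comp hm) measurable_const

end HittingClosed

/-! ### The stopped clock `t ↦ t ∧ τ` and continuity of stopped paths -/

section StoppedClock

/-- The junk-valued `untopA` of a finite time is the time (`rfl`). [folklore] -/
theorem untopA_coe (T : ℝ≥0) : (T : WithTop ℝ≥0).untopA = T := rfl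

/-- The stopped clock against `⊤` is the running time. [folklore] -/
theorem untopA_min_coe_top (t : ℝ≥0) : (min (t : WithTop ℝ≥0) ⊤).untopA = t := by
  rw [min_eq_left le_top]; rfl

/-- The stopped clock against a finite time `T` is `t ∧ T`. [folklore] -/
theorem untopA_min_coe_coe (t T : ℝ≥0) :
    (min (t : WithTop ℝ≥0) (T : WithTop ℝ≥0)).untopA = min t T := by
  rw [← WithTop.coe_min]; rfl

/-- The stopped clock `t ↦ t ∧ τ` (read in `ℝ≥0`) is continuous. [folklore] -/
theorem continuous_untopA_min_coe (c : WithTop ℝ≥0) :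
    Continuous fun t : ℝ≥0 ↦ (min (t : WithTop ℝ≥0) c).untopA := by
  induction c with
  | top =>
    have : (fun t : ℝ≥0 ↦ (min (t : WithTop ℝ≥0) ⊤).untopA) = id := funext untopA_min_coe_top
    rw [this]
    exact continuous_id
  | coe T =>
    have : (fun t : ℝ≥0 ↦ (min (t : WithTop ℝ≥0) (T : WithTop ℝ≥0)).untopA) = fun t ↦ min t T :=
      funext fun t ↦ untopA_min_coe_coe t T
    rw [this]
    exact continuous_id.min continuous_const

/-- The stopped clock is dominated by the running time (same statement and argument order as
`Literature.Analysis.FunctionSpaces.untopA_min_le` of `Literature.Analysis.FunctionSpaces.ItoProcessesProofs`, see the module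
docstring). [folklore] -/
theorem untopA_min_coe_le (t : ℝ≥0) (c : WithTop ℝ≥0) :
    (min (t : WithTop ℝ≥0) c).untopA ≤ t := by
  induction c with
  | top => rw [untopA_min_coe_top]
  | coe T => rw [untopA_min_coe_coe]; exact min_le_left _ _

/-- The stopped clock is `1`-Lipschitz in time: `|t ∧ τ - s ∧ τ| ≤ |t - s|`. [folklore] -/
theorem dist_untopA_min_coe_le (c : WithTop ℝ≥0) (s t : ℝ≥0) :
    dist (min (t : WithTop ℝ≥0) c).untopA (min (s : WithTop ℝ≥0) c).untopA ≤ dist t s := by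
  induction c with
  | top => rw [untopA_min_coe_top, untopA_min_coe_top]
  | coe T =>
    rw [untopA_min_coe_coe, untopA_min_coe_coe, NNReal.dist_eq, NNReal.dist_eq, NNReal.coe_min,
      NNReal.coe_min]
    have h := abs_min_sub_min_le_max (t : ℝ) T s T
    rwa [sub_self, abs_zero, max_eq_left (abs_nonneg _)] at h

/-- Paths of a stopped process with continuous paths (values in any topological space, any random
time) are continuous (the `ℝ`-valued case is also `Literature.Analysis.FunctionSpaces.continuous_stoppedProcess_apply` of
`Literature.Analysis.FunctionSpaces.ItoProcessesProofs`, see the module docstring). [folklore] -/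
theorem continuous_stoppedProcess_path [TopologicalSpace E] {u : ℝ≥0 → Ω → E} {ω : Ω}
    (hc : Continuous fun t ↦ u t ω) (τ : Ω → WithTop ℝ≥0) :
    Continuous fun t ↦ stoppedProcess u τ t ω := by
  unfold stoppedProcess
  exact hc.comp (continuous_untopA_min_coe (τ ω))

end StoppedClock

/-! ### Exit from an open interval; the stopped process -/

section Exit

variable {u : ℝ≥0 → Ω → ℝ} {a b : ℝ} {ω : Ω}

/-- The **exit time** of the real process `u` from the open interval `(a, b)`: the first hitting
time of the closed set `(a, b)ᶜ` (`⊤` if the path stays in `(a, b)` forever). **Junk case**: for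
`b ≤ a` the interval is empty, `(a, b)ᶜ = univ` and `exitTime u a b = 0` identically (Mathlib
`hittingAfter_univ`); the endpoint lemmas below all assume `u 0 ω ∈ Ioo a b`, which excludes it.
Rohde–Schramm (2005), proof of Lemma 6.2 (`T := inf{t ≥ 0 : Y_x(t) ∉ (a, b)}`).
[cite: RohdeSchramm2005, §6 proof of Lemma 6.2] -/
def exitTime (u : ℝ≥0 → Ω → ℝ) (a b : ℝ) : Ω → WithTop ℝ≥0 :=
  hittingAfter u (Set.Ioo a b)ᶜ 0

/-- Unfolding of `exitTime`. [folklore] -/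
theorem exitTime_def (u : ℝ≥0 → Ω → ℝ) (a b : ℝ) :
    exitTime u a b = hittingAfter u (Set.Ioo a b)ᶜ 0 := rfl

/-- Before the exit time the path is inside the interval. [folklore] -/
theorem mem_Ioo_of_coe_lt_exitTime {t : ℝ≥0} (h : (t : WithTop ℝ≥0) < exitTime u a b ω) :
    u t ω ∈ Ioo a b := by
  have := notMem_of_coe_lt_hittingAfter_zero (s := (Set.Ioo a b)ᶜ) h
  rwa [mem_compl_iff, not_not] at this

/-- At a finite exit time the path is outside the open interval (continuous path). [folklore] -/
theorem notMem_Ioo_of_exitTime_eq_coe (hc : Continuous fun t ↦ u t ω) {T : ℝ≥0}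
    (hT : exitTime u a b ω = T) : u T ω ∉ Ioo a b :=
  mem_of_hittingAfter_zero_eq_coe isOpen_Ioo.isClosed_compl hc hT

/-- A path started inside the interval has positive exit time. [folklore] -/
theorem exitTime_pos (hc : Continuous fun t ↦ u t ω) (h0 : u 0 ω ∈ Ioo a b) :
    0 < exitTime u a b ω := by
  rcases eq_or_ne (exitTime u a b ω) ⊤ with htop | hne
  · rw [htop]; exact WithTop.coe_lt_top 0
  · obtain ⟨T, hT⟩ := WithTop.ne_top_iff_exists.1 hne
    rw [← hT, WithTop.coe_pos]
    refine pos_iff_ne_zero.2 fun hT0 ↦ ?_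
    have := notMem_Ioo_of_exitTime_eq_coe hc hT.symm
    rw [hT0] at this
    exact this h0

/-- `{τ ≤ t}` iff the path has left the interval by time `t` (continuous path). [folklore] -/
theorem exitTime_le_coe_iff (hc : Continuous fun t ↦ u t ω) {t : ℝ≥0} :
    exitTime u a b ω ≤ t ↔ ∃ j ≤ t, u j ω ∉ Ioo a b :=
  hittingAfter_zero_le_coe_iff isOpen_Ioo.isClosed_compl hc

/-- **At the exit time the path sits at an endpoint**: if the path starts in `(a, b)` and exits at
the finite time `T`, then `u T ω = a` or `u T ω = b` (it is in `[a, b]` as a limit of points of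
`(a, b)` from the left, and not in `(a, b)`). [folklore] -/
theorem apply_eq_or_eq_of_exitTime_eq_coe (hc : Continuous fun t ↦ u t ω) (h0 : u 0 ω ∈ Ioo a b)
    {T : ℝ≥0} (hT : exitTime u a b ω = T) : u T ω = a ∨ u T ω = b := by
  have hout := notMem_Ioo_of_exitTime_eq_coe hc hT
  have hTpos : 0 < T := by
    have := exitTime_pos hc h0
    rw [hT, WithTop.coe_pos] at this
    exact this
  -- the values before `T` are in `(a, b)`; pass to the limit `t ↑ T`
  haveI : (𝓝[<] T).NeBot := nhdsLT_neBot_of_exists_lt ⟨0, hTpos⟩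
  have hlim : Tendsto (fun t ↦ u t ω) (𝓝[<] T) (𝓝 (u T ω)) :=
    (hc.tendsto T).mono_left nhdsWithin_le_nhds
  have hev : ∀ᶠ t in 𝓝[<] T, u t ω ∈ Ioo a b := by
    filter_upwards [self_mem_nhdsWithin] with t ht
    exact mem_Ioo_of_coe_lt_exitTime (by rw [hT]; exact WithTop.coe_lt_coe.2 ht)
  have ha : a ≤ u T ω := ge_of_tendsto hlim (hev.mono fun t ht ↦ ht.1.le)
  have hb : u T ω ≤ b := le_of_tendsto hlim (hev.mono fun t ht ↦ ht.2.le)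
  rw [mem_Ioo, not_and_or, not_lt, not_lt] at hout
  rcases hout with h | h
  · exact Or.inl (le_antisymm h ha)
  · exact Or.inr (le_antisymm hb h)

/-- Before the exit time the stopped process is the process (Mathlib `stoppedProcess_eq_of_le`).
[folklore] -/
theorem stoppedProcess_exitTime_eq_of_le {t : ℝ≥0} (h : (t : WithTop ℝ≥0) ≤ exitTime u a b ω) :
    stoppedProcess u (exitTime u a b) t ω = u t ω :=
  stoppedProcess_eq_of_le h

/-- From a finite exit time `T` on, the stopped process sits at `u T ω`. [folklore] -/
theorem stoppedProcess_exitTime_eq_of_ge {T t : ℝ≥0} (hT : exitTime u a b ω = T) (h : T ≤ t) :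
    stoppedProcess u (exitTime u a b) t ω = u T ω := by
  rw [stoppedProcess_eq_of_ge (by rw [hT]; exact WithTop.coe_le_coe.2 h), hT, untopA_coe]

/-- **The process stopped at its exit time stays in `[a, b]`** (start inside, continuous path).
[folklore] -/
theorem stoppedProcess_exitTime_mem_Icc (hc : Continuous fun t ↦ u t ω) (h0 : u 0 ω ∈ Ioo a b)
    (t : ℝ≥0) : stoppedProcess u (exitTime u a b) t ω ∈ Icc a b := by
  rcases lt_or_ge (t : WithTop ℝ≥0) (exitTime u a b ω) with hlt | hle
  · rw [stoppedProcess_exitTime_eq_of_le hlt.le]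
    exact Ioo_subset_Icc_self (mem_Ioo_of_coe_lt_exitTime hlt)
  · obtain ⟨T, hT⟩ := WithTop.ne_top_iff_exists.1 (ne_top_of_le_ne_top WithTop.coe_ne_top hle)
    have hTt : T ≤ t := by rw [← hT] at hle; exact WithTop.coe_le_coe.1 hle
    rw [stoppedProcess_exitTime_eq_of_ge hT.symm hTt]
    rcases apply_eq_or_eq_of_exitTime_eq_coe hc h0 hT.symm with h | h
    · rw [h]; exact left_mem_Icc.2 (h0.1.le.trans h0.2.le)
    · rw [h]; exact right_mem_Icc.2 (h0.1.le.trans h0.2.le)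

/-- If the stopped process is strictly inside the interval at time `t`, the exit time is `> t`
(at and after a finite exit time it sits at an endpoint). [folklore] -/
theorem coe_lt_exitTime_of_stoppedProcess_mem_Ioo (hc : Continuous fun t ↦ u t ω)
    (h0 : u 0 ω ∈ Ioo a b) {t : ℝ≥0}
    (h : stoppedProcess u (exitTime u a b) t ω ∈ Ioo a b) :
    (t : WithTop ℝ≥0) < exitTime u a b ω := by
  by_contra hle
  rw [not_lt] at hle
  obtain ⟨T, hT⟩ := WithTop.ne_top_iff_exists.1 (ne_top_of_le_ne_top WithTop.coe_ne_top hle)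
  have hTt : T ≤ t := by rw [← hT] at hle; exact WithTop.coe_le_coe.1 hle
  rw [stoppedProcess_exitTime_eq_of_ge hT.symm hTt] at h
  rcases apply_eq_or_eq_of_exitTime_eq_coe hc h0 hT.symm with h' | h'
  · rw [h'] at h; exact lt_irrefl _ h.1
  · rw [h'] at h; exact lt_irrefl _ h.2

/-- The stopped process equals the endpoint `a` at time `t` iff the path has exited by time `t`
through `a`: `S t = a ↔ ∃ T ≤ t, τ = T ∧ u T = a`. [folklore] -/
theorem stoppedProcess_exitTime_eq_left_iff {t : ℝ≥0} :
    stoppedProcess u (exitTime u a b) t ω = a ↔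
      ∃ T : ℝ≥0, T ≤ t ∧ exitTime u a b ω = T ∧ u T ω = a := by
  constructor
  · intro h
    have hle : exitTime u a b ω ≤ t := by
      by_contra hlt
      rw [not_le] at hlt
      have := mem_Ioo_of_coe_lt_exitTime hlt
      rw [← stoppedProcess_exitTime_eq_of_le hlt.le, h] at this
      exact lt_irrefl _ this.1
    obtain ⟨T, hT⟩ := WithTop.ne_top_iff_exists.1 (ne_top_of_le_ne_top WithTop.coe_ne_top hle)
    have hTt : T ≤ t := by rw [← hT] at hle; exact WithTop.coe_le_coe.1 hle
    refine ⟨T, hTt, hT.symm, ?_⟩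
    rwa [stoppedProcess_exitTime_eq_of_ge hT.symm hTt] at h
  · rintro ⟨T, hTt, hT, hTa⟩
    rw [stoppedProcess_exitTime_eq_of_ge hT hTt, hTa]

/-- The stopped process equals the endpoint `b` at time `t` iff the path has exited by time `t`
through `b`. [folklore] -/
theorem stoppedProcess_exitTime_eq_right_iff {t : ℝ≥0} :
    stoppedProcess u (exitTime u a b) t ω = b ↔
      ∃ T : ℝ≥0, T ≤ t ∧ exitTime u a b ω = T ∧ u T ω = b := by
  constructor
  · intro h
    have hle : exitTime u a b ω ≤ t := by
      by_contra hlt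
      rw [not_le] at hlt
      have := mem_Ioo_of_coe_lt_exitTime hlt
      rw [← stoppedProcess_exitTime_eq_of_le hlt.le, h] at this
      exact lt_irrefl _ this.2
    obtain ⟨T, hT⟩ := WithTop.ne_top_iff_exists.1 (ne_top_of_le_ne_top WithTop.coe_ne_top hle)
    have hTt : T ≤ t := by rw [← hT] at hle; exact WithTop.coe_le_coe.1 hle
    refine ⟨T, hTt, hT.symm, ?_⟩
    rwa [stoppedProcess_exitTime_eq_of_ge hT.symm hTt] at h
  · rintro ⟨T, hTt, hT, hTb⟩
    rw [stoppedProcess_exitTime_eq_of_ge hT hTt, hTb]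

variable {f : Filtration ℝ≥0 mΩ}

/-- **The exit time is a stopping time** (adapted process with continuous paths, raw filtration).
Revuz–Yor (1999), Ch. I, §4, Prop. (4.6). [folklore] -/
theorem isStoppingTime_exitTime (hu : Adapted f u) (hc : ∀ ω, Continuous fun t ↦ u t ω) :
    IsStoppingTime f (exitTime u a b) :=
  isStoppingTime_hittingAfter_of_continuous hu hc isOpen_Ioo.isClosed_compl

/-- **The process stopped at its exit time is strongly adapted** (Mathlib: a continuous strongly
adapted process is strongly progressive, and a strongly progressive process stopped at a stopping
time is strongly adapted). Revuz–Yor (1999), Ch. I, §4, Prop. (4.8) ff. [folklore] -/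
theorem stronglyAdapted_stoppedProcess_exitTime (hu : Adapted f u)
    (hc : ∀ ω, Continuous fun t ↦ u t ω) :
    StronglyAdapted f (stoppedProcess u (exitTime u a b)) :=
  (StronglyAdapted.isStronglyProgressive_of_continuous (fun i ↦ (hu i).stronglyMeasurable)
    hc).stronglyAdapted_stoppedProcess (isStoppingTime_exitTime hu hc)

/-- The events `{τ ≤ t}` of the exit time are `f t`-measurable. [folklore] -/
theorem measurableSet_exitTime_le (hu : Adapted f u) (hc : ∀ ω, Continuous fun t ↦ u t ω)
    (t : ℝ≥0) : MeasurableSet[f t] {ω | exitTime u a b ω ≤ t} :=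
  isStoppingTime_exitTime hu hc t

/-- The events `{t < τ}` ("not yet exited") are `f t`-measurable. [folklore] -/
theorem measurableSet_coe_lt_exitTime (hu : Adapted f u)
    (hc : ∀ ω, Continuous fun t ↦ u t ω) (t : ℝ≥0) :
    MeasurableSet[f t] {ω | (t : WithTop ℝ≥0) < exitTime u a b ω} := by
  have : {ω | (t : WithTop ℝ≥0) < exitTime u a b ω} = {ω | exitTime u a b ω ≤ t}ᶜ := by
    ext ω; simp
  rw [this]
  exact (measurableSet_exitTime_le hu hc t).compl

end Exit

end Literature.Probability.Process
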